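import Summits.HubbardSuperconductivity.HubbardSuperconductivity.Theorems.TwTipContinuation.Negative.SeedContinuity

/-!
# `TwTipContinuation` (stmt-HubbardSuperconductivity-1700) — line `isogap-submodular-transport`,
# stub `stub_danskinAttainment` (finite-dimensional Danskin attainment at the corner `s = 0`)

Seeded family `H_L(U,s) = hubbardTorus 2 L 1 U − (s/L²) P_L`, `P_L = (pairField d L)ᴴ (pairField d L) ≥ 0`,
sector `szSector (2n) 0`, sector energy `E_L(U,s) = minEnergyOn (H_L(U,s)) (szSector (2n) 0)`.

If the seed gains energy at least linearly, `B·s ≤ E_L(U,0) − E_L(U,s)` for all `0 < s < s₁`, then SOME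
normalised sector ground state `ψ₀` of the PURE torus `hubbardTorus 2 L 1 U` has `B L² ≤ re⟨ψ₀, P_L ψ₀⟩`.

Proof (no spectral gap, compactness only): for every seed `s ∈ (0, s₁/2]` and every normalised sector
ground state `ψ` of `H_L(U,s)`, the left chord from `0` (variational principle at seed `0`,
`leftChord_le_order`) gives `E_L(U,0) − E_L(U,s) ≤ (s/L²)·re⟨ψ,P_Lψ⟩`, hence with the hypothesis
`B L² ≤ re⟨ψ,P_Lψ⟩` uniformly in `s`; the attractive-side Danskin lemma
`exists_groundState_order_of_uniformSeeds` (subsequential limit of ground states along `s ↓ 0` on the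
unit sphere, closure of the ground-state relation) then produces a ground state of `H_L(U,0)`, which is
the pure torus (`seededH_zero`). Danskin (1966); Griffiths, J. Math. Phys. 5 (1964) 1215; Kato (1966)
II §6; Tasaki (2020) §2.1–2.2. Folklore finite-dimensional analysis; no definition is introduced.
-/

noncomputable section

namespace Summit.HubbardSuperconductivity.TwTipContinuation.IsogapTransport

open Matrix Filter Finset
open Literature.MathematicalPhysics.QuantumLattice Literature.Probability.LatticeModels
open Summit.HubbardSuperconductivity.TwTipContinuation.Negative
open scoped ComplexOrder

/-- **Finite-dimensional Danskin attainment.** If `B·s ≤ E_L(U,0) − E_L(U,s)` for all `0 < s < s₁`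
(sector `(2n, S^z = 0)`, `n ≤ |Λ_L|`), then some normalised sector ground state `ψ₀` of the pure torus
`hubbardTorus 2 L 1 U` has `B L² ≤ re⟨ψ₀, P_L ψ₀⟩`: the right derivative of the concave
`s ↦ E_L(U,s)` at `0` is `−L⁻² max_{GS} re⟨ψ, P_L ψ⟩`, and the maximum is attained (left chord from `0`
at every seed `s ∈ (0, s₁/2]` plus a subsequential limit of ground states along `s ↓ 0`).
Danskin (1966); Griffiths (1964); Kato (1966) II §6. [folklore] -/
theorem stub_danskinAttainment :
    ∀ (L : ℕ) [NeZero L] (U : ℝ) (n : ℕ) (B s₁ : ℝ), n ≤ Fintype.card (FermionTorus 2 L) → 0 < s₁ →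
      (∀ s ∈ Set.Ioo (0 : ℝ) s₁, B * s ≤
        (Matrix.minEnergyOn (hubbardTorus 2 L 1 U) (szSector (2 * n) 0))
          - (Matrix.minEnergyOn (hubbardTorus 2 L 1 U - ((s / (L : ℝ) ^ 2 : ℝ) : ℂ) • ((pairField dWaveFormFactor L)ᴴ * pairField dWaveFormFactor L)) (szSector (2 * n) 0))) →
      ∃ ψ : Fock (Orb (FermionTorus 2 L)), star ψ ⬝ᵥ ψ = 1 ∧ IsGroundStateInSector (hubbardTorus 2 L 1 U) (2 * n) 0 ψ ∧
        B * (L : ℝ) ^ 2 ≤ (expect ((pairField dWaveFormFactor L)ᴴ * pairField dWaveFormFactor L) ψ).re := by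
  intro L _ U n B s₁ hn hs₁ hB
  have hL : (0 : ℝ) < (L : ℝ) ^ 2 := by
    have := NeZero.pos L
    positivity
  -- every normalised sector ground state at a seed `g ∈ (0, s₁/2]` carries `B L²` (left chord from `0`)
  have hkey : ∀ g : ℝ, 0 < g → g ≤ s₁ / 2 → ∀ ψ : Fock (Orb (FermionTorus 2 L)), star ψ ⬝ᵥ ψ = 1 →
      IsGroundStateInSector (hubbardTorus 2 L 1 U - ((g / (L : ℝ) ^ 2 : ℝ) : ℂ) • ((pairField dWaveFormFactor L)ᴴ * pairField dWaveFormFactor L)) (2 * n) 0 ψ →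
        B * (L : ℝ) ^ 2 ≤ (expect ((pairField dWaveFormFactor L)ᴴ * pairField dWaveFormFactor L) ψ).re := by
    intro g hg hg₁ ψ hψ hgs
    have h1 := hB g ⟨hg, by linarith⟩
    have h2 := leftChord_le_order (U := U) (g := g) (g' := 0) hg hψ hgs
    rw [seededH_zero, sub_zero] at h2
    have h3 : B * g ≤ g / (L : ℝ) ^ 2 *
        (expect ((pairField dWaveFormFactor L)ᴴ * pairField dWaveFormFactor L) ψ).re := h1.trans h2
    have h4 : g * (B * (L : ℝ) ^ 2) ≤
        g * (expect ((pairField dWaveFormFactor L)ᴴ * pairField dWaveFormFactor L) ψ).re := by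
      have e : g / (L : ℝ) ^ 2 * (expect ((pairField dWaveFormFactor L)ᴴ * pairField dWaveFormFactor L) ψ).re *
            (L : ℝ) ^ 2 =
          g * (expect ((pairField dWaveFormFactor L)ᴴ * pairField dWaveFormFactor L) ψ).re := by
        rw [div_mul_eq_mul_div, div_mul_cancel₀ _ hL.ne']
      rw [← e]
      calc g * (B * (L : ℝ) ^ 2) = B * g * (L : ℝ) ^ 2 := by ring
        _ ≤ _ := mul_le_mul_of_nonneg_right h3 hL.le
    exact le_of_mul_le_mul_left h4 hg
  obtain ⟨ψ, hψ, hgs, hb⟩ := exists_groundState_order_of_uniformSeeds (U := U) hn (half_pos hs₁) hkey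
  rw [seededH_zero] at hgs
  exact ⟨ψ, hψ, hgs, hb⟩

end Summit.HubbardSuperconductivity.TwTipContinuation.IsogapTransport
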